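import Summits.ABC.ABC.Theses.CubicResolventAllowance
import Summits.ABC.ABC.Theorems.CubicResolventAllowanceResolventDiscBounds
import Literature.NumberTheory.EllipticCurves.SzpiroOfAbcProofs
import Literature.NumberTheory.EllipticCurves.PastenValuationProductMestreOesterleProofs

/-!
# Stub ideation k=1 for `stub_realCubic` (family 1: recognise & import), rev 3 / gen 3 —
# on-path certificates, the class-Szpiro window, and the prime-conductor calibration.
Crux `IndexSzpiro` (stmt-ABC-22740), route `CubicResolventAllowance`; companion plan
`STUB-IDEAS-stub_realCubic-1.md` (rev 3).  Rev-2 helpers (Plans A/B/C: twist normalisation,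
M–O prime-power rung, reduced K-free core) stay in `StubIdeas1RealSketch.lean` (rc 0, 4 sorries =
the 4 proposed helpers A2, A4, B1, B2) and are not repeated here.

SKETCH, self-contained (imports only tree modules; does not import any `Cruxes/…Sketch` file).
This file is `sorry`-FREE: every hypothesis that is not a tree theorem is an explicit `Prop`
argument (`IndexIdentity` = k3's N1★, `DiscrDvdFourConductor` = k3's L♮, `MestreOesterleThm2…` =
Mestre–Oesterlé §5 Théorème 2, to be typed as a named Literature fact).  Typed ≠ proved; nothing here
is progress on abc/Szpiro — these are CERTIFICATES about where the stub sits: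

§1  ON-PATH: `SzpiroConjecture → StubRealCubic`, `IndexSzpiro → StubRealCubic`, `ABC → IndexSzpiro`
    (tree `szpiro_of_abcLe_holds`), hence `¬ StubRealCubic → ¬ ABC`: refuting the stub refutes the summit.
§2  WINDOW: with the class-Szpiro statement `SzpiroOnRealClass s` (`Δ_min ≤ C·N^{s+ε}` on the real
    `r = 0` class), `SzpiroOnRealClass 6 → StubRealCubic → SzpiroOnRealClass 8` UNCONDITIONALLY (the
    landed item `ResolventDiscBounds`: `|d_K| ≤ 1944·N²`), and `→ SzpiroOnRealClass 7` modulo L♮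
    (`|d_K| ∣ 4N`).  So the stub is class-Szpiro with exponent in `[6+ε, 8+ε]` (resp. `[6+ε, 7+ε]`).
§3  CALIBRATION on prime conductor `N = p`: `Δ_min ≤ |d_K|·N⁴` (ε-free, `C = 1`, both signs) from the
    vendored tree fact `mestreOesterle_factorization_le_five` (M–O Thm 1) + N1★ via PARITY
    (`v_p(Δ_min)` odd ⇒ `p ∣ d_K`); and `Δ_min ≤ |d_K|` off `p ∈ {11, 19, 37}`, `Δ_min ≤ |d_K|·N²` for
    `p ≠ 11`, modulo M–O Thm 2 (no-rational-2-torsion form).  I.e. on this class the allowance `|d_K|`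
    is USED (index `I ∣ 16`), not merely `≥ 1`.
-/

set_option linter.dupNamespace false

noncomputable section

namespace Summit.ABC.ABC.Cruxes.IndexSzpiro.StubIdeas1RealG3

open Summit.ABC.ABC.Theses.CubicResolventAllowance
open Literature.NumberTheory.EllipticCurves Literature.NumberTheory.DiophantineGeometry

/-! ## §0 The registered stub, verbatim, as a Prop (same normalised signature as rev 2 / k2 / k3) -/

/-- `stub_realCubic` (the `d_K > 0` half of `IndexSzpiro`), verbatim registered signature. -/
def StubRealCubic : Prop :=
  ∀ ε : ℝ, 0 < ε → ∃ C : ℝ, ∀ (W : WeierstrassCurve ℚ) [W.IsElliptic] (K : Type) [Field K]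
    [NumberField K], Irreducible W.twoTorsionPolynomial.toPoly → Module.finrank ℚ K = 3 →
    (∃ θ : K, Polynomial.aeval θ W.twoTorsionPolynomial.toPoly = 0) → 0 < NumberField.discr K →
    (W.minimalDiscriminantNorm ℤ : ℝ) ≤
      C * |(NumberField.discr K : ℝ)| * (W.conductorNorm ℤ : ℝ) ^ (6 + ε)

/-- Class-Szpiro with exponent `s + ε` on the real `r = 0` class (K-free conclusion; the class
hypotheses are kept so that the statements compose with the stub). -/
def SzpiroOnRealClass (s : ℝ) : Prop :=
  ∀ ε : ℝ, 0 < ε → ∃ C : ℝ, ∀ (W : WeierstrassCurve ℚ) [W.IsElliptic] (K : Type) [Field K]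
    [NumberField K], Irreducible W.twoTorsionPolynomial.toPoly → Module.finrank ℚ K = 3 →
    (∃ θ : K, Polynomial.aeval θ W.twoTorsionPolynomial.toPoly = 0) → 0 < NumberField.discr K →
    (W.minimalDiscriminantNorm ℤ : ℝ) ≤ C * (W.conductorNorm ℤ : ℝ) ^ (s + ε)

/-- A discriminant law of shape `|d_K| ≤ A·N^k` on the `r = 0` class (landed: `A = 1944, k = 2`,
item `ResolventDiscBounds`; conjectured sharp: `A = 4, k = 1`, k3's L♮). -/
def DiscrLaw (A : ℝ) (k : ℕ) : Prop :=
  ∀ (W : WeierstrassCurve ℚ) [W.IsElliptic] (K : Type) [Field K] [NumberField K],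
    Irreducible W.twoTorsionPolynomial.toPoly → Module.finrank ℚ K = 3 →
    (∃ θ : K, Polynomial.aeval θ W.twoTorsionPolynomial.toPoly = 0) →
    |(NumberField.discr K : ℝ)| ≤ A * (W.conductorNorm ℤ : ℝ) ^ k

/-- `1 ≤ |d_K|` as reals (the only use of `K` a K-blind proof can make). -/
theorem one_le_abs_discr (K : Type) [Field K] [NumberField K] :
    (1 : ℝ) ≤ |(NumberField.discr K : ℝ)| := by
  have h1 : (1 : ℤ) ≤ |NumberField.discr K| := Int.one_le_abs (NumberField.discr_ne_zero K)
  have h2 : ((1 : ℤ) : ℝ) ≤ ((|NumberField.discr K| : ℤ) : ℝ) := by exact_mod_cast h1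
  simpa [Int.cast_abs] using h2

/-! ## §1 On-path certificates (tree match: what implies the stub, what the stub's negation kills) -/

/-- The crux trivially gives its real half. -/
theorem stubRealCubic_of_indexSzpiro (h : IndexSzpiro) : StubRealCubic := by
  intro ε hε
  obtain ⟨C, hC⟩ := h ε hε
  exact ⟨C, fun W _ K _ _ hirr hdeg hθ _ => hC W K hirr hdeg hθ⟩

/-- `SzpiroOnRealClass 6 → StubRealCubic`: a K-blind bound needs only `|d_K| ≥ 1`. -/
theorem stubRealCubic_of_szpiroOnRealClass_six (h : SzpiroOnRealClass 6) : StubRealCubic := by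
  intro ε hε
  obtain ⟨C, hC⟩ := h ε hε
  refine ⟨max C 0, ?_⟩
  intro W _ K _ _ hirr hdeg hθ hpos
  have h1 := hC W K hirr hdeg hθ hpos
  have hd := one_le_abs_discr K
  have hrpow : (0 : ℝ) ≤ (W.conductorNorm ℤ : ℝ) ^ ((6 : ℝ) + ε) :=
    Real.rpow_nonneg (Nat.cast_nonneg _) _
  calc (W.minimalDiscriminantNorm ℤ : ℝ) ≤ C * (W.conductorNorm ℤ : ℝ) ^ ((6 : ℝ) + ε) := h1
    _ ≤ max C 0 * (W.conductorNorm ℤ : ℝ) ^ ((6 : ℝ) + ε) :=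
        mul_le_mul_of_nonneg_right (le_max_left _ _) hrpow
    _ = max C 0 * 1 * (W.conductorNorm ℤ : ℝ) ^ ((6 : ℝ) + ε) := by ring
    _ ≤ max C 0 * |(NumberField.discr K : ℝ)| * (W.conductorNorm ℤ : ℝ) ^ ((6 : ℝ) + ε) :=
        mul_le_mul_of_nonneg_right (mul_le_mul_of_nonneg_left hd (le_max_right _ _)) hrpow

/-- Szpiro's conjecture restricted to the class. -/
theorem szpiroOnRealClass_six_of_szpiro (h : SzpiroConjecture) : SzpiroOnRealClass 6 := by
  intro ε hε
  obtain ⟨C, hC⟩ := h ε hε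
  exact ⟨C, fun W _ K _ _ _ _ _ _ => hC W⟩

/-- **On path, I:** `SzpiroConjecture → stub_realCubic`. -/
theorem stubRealCubic_of_szpiro (h : SzpiroConjecture) : StubRealCubic :=
  stubRealCubic_of_szpiroOnRealClass_six (szpiroOnRealClass_six_of_szpiro h)

/-- `SzpiroConjecture → IndexSzpiro` (the whole crux, both signs). -/
theorem indexSzpiro_of_szpiro (h : SzpiroConjecture) : IndexSzpiro := by
  intro ε hε
  obtain ⟨C, hC⟩ := h ε hε
  refine ⟨max C 0, ?_⟩
  intro W _ K _ _ _ _ _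
  have h1 := hC W
  have hd := one_le_abs_discr K
  have hrpow : (0 : ℝ) ≤ (W.conductorNorm ℤ : ℝ) ^ (6 + ε) := Real.rpow_nonneg (Nat.cast_nonneg _) _
  calc (W.minimalDiscriminantNorm ℤ : ℝ) ≤ C * (W.conductorNorm ℤ : ℝ) ^ (6 + ε) := h1
    _ ≤ max C 0 * (W.conductorNorm ℤ : ℝ) ^ (6 + ε) := mul_le_mul_of_nonneg_right (le_max_left _ _) hrpow
    _ = max C 0 * 1 * (W.conductorNorm ℤ : ℝ) ^ (6 + ε) := by ring
    _ ≤ max C 0 * |(NumberField.discr K : ℝ)| * (W.conductorNorm ℤ : ℝ) ^ (6 + ε) :=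
        mul_le_mul_of_nonneg_right (mul_le_mul_of_nonneg_left hd (le_max_right _ _)) hrpow

/-- The summit `ABC` (strict form, `0 < C`) gives the `≤`-form consumed by `szpiro_of_abcLe_holds`
(same three lines as `Cruxes/ManyPrimeValuationProduct/Disproof.abcLe_of_abc`, inlined to keep this
file free of `Disproof` imports). -/
theorem abcLe_of_abc (h : _root_.ABC) :
    ∀ ε : ℝ, 0 < ε → ∃ C : ℝ, ∀ a b c : ℕ, IsABCTriple a b c →
      (c : ℝ) ≤ C * ((rad a b c : ℕ) : ℝ) ^ (1 + ε) := by
  intro ε hε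
  obtain ⟨C, -, hC⟩ := (ABC_iff.mp h) ε hε
  exact ⟨C, fun a b c habc => (hC a b c habc).le⟩

/-- **On path, II:** `ABC → IndexSzpiro` (Silverman VIII.11.5(b) = tree `szpiro_of_abcLe_holds`). The
crux, hence the stub, is a CONSEQUENCE of the summit. -/
theorem indexSzpiro_of_abc (h : _root_.ABC) : IndexSzpiro :=
  indexSzpiro_of_szpiro (szpiro_of_abcLe_holds (abcLe_of_abc h))

/-- `ABC → stub_realCubic`. -/
theorem stubRealCubic_of_abc (h : _root_.ABC) : StubRealCubic :=
  stubRealCubic_of_indexSzpiro (indexSzpiro_of_abc h)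

/-- **Why the stub resists refutation:** a disproof of `stub_realCubic` is a disproof of abc (and of
Szpiro).  Nothing short of `¬ ABC` kills it. -/
theorem not_abc_of_not_stubRealCubic (h : ¬ StubRealCubic) : ¬ _root_.ABC :=
  fun habc => h (stubRealCubic_of_abc habc)

theorem not_szpiro_of_not_stubRealCubic (h : ¬ StubRealCubic) : ¬ SzpiroConjecture :=
  fun hs => h (stubRealCubic_of_szpiro hs)

/-! ## §2 The class-Szpiro window: `[6+ε, 8+ε]` unconditionally, `[6+ε, 7+ε]` modulo L♮ -/

/-- **Window glue.** A discriminant law `|d_K| ≤ A·N^k` turns the stub into class-Szpiro `6 + k`. -/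
theorem szpiroOnRealClass_of_stub {A : ℝ} {k : ℕ} (hlaw : DiscrLaw A k) (h : StubRealCubic) :
    SzpiroOnRealClass (6 + k) := by
  intro ε hε
  obtain ⟨C, hC⟩ := h ε hε
  refine ⟨max C 0 * A, ?_⟩
  intro W _ K _ _ hirr hdeg hθ hpos
  have hN : (0 : ℝ) < (W.conductorNorm ℤ : ℝ) := by exact_mod_cast W.conductorNorm_pos_holds
  have h1 := hC W K hirr hdeg hθ hpos
  have h2 := hlaw W K hirr hdeg hθ
  have hrpow : (0 : ℝ) ≤ (W.conductorNorm ℤ : ℝ) ^ (6 + ε) := Real.rpow_nonneg hN.le _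
  have hsplit : (W.conductorNorm ℤ : ℝ) ^ ((6 + (k : ℝ)) + ε) =
      (W.conductorNorm ℤ : ℝ) ^ k * (W.conductorNorm ℤ : ℝ) ^ (6 + ε) := by
    rw [show (6 + (k : ℝ)) + ε = (k : ℝ) + (6 + ε) by ring, Real.rpow_add hN, Real.rpow_natCast]
  calc (W.minimalDiscriminantNorm ℤ : ℝ)
        ≤ C * |(NumberField.discr K : ℝ)| * (W.conductorNorm ℤ : ℝ) ^ (6 + ε) := h1
    _ ≤ max C 0 * |(NumberField.discr K : ℝ)| * (W.conductorNorm ℤ : ℝ) ^ (6 + ε) :=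
        mul_le_mul_of_nonneg_right (mul_le_mul_of_nonneg_right (le_max_left C 0) (abs_nonneg _)) hrpow
    _ ≤ max C 0 * (A * (W.conductorNorm ℤ : ℝ) ^ k) * (W.conductorNorm ℤ : ℝ) ^ (6 + ε) :=
        mul_le_mul_of_nonneg_right (mul_le_mul_of_nonneg_left h2 (le_max_right C 0)) hrpow
    _ = max C 0 * A * (W.conductorNorm ℤ : ℝ) ^ ((6 + (k : ℝ)) + ε) := by rw [hsplit]; ring

/-- **Landed law** `|d_K| ≤ 1944·N²` (route item `ResolventDiscBounds`, stmt-ABC-22743, PROVED: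
`Summit.ABC.ABC.Theorems.resolventDiscBounds_proof`). -/
theorem discrLaw_1944_2 : DiscrLaw 1944 2 :=
  fun W _ K _ _ hirr hdeg hθ => Summit.ABC.ABC.Theorems.resolventDiscBounds_proof.1 W K hirr hdeg hθ

/-- **Unconditional upper edge of the window:** `stub_realCubic ⇒ Szpiro(8+ε)` on the real class. -/
theorem szpiroOnRealClass_eight_of_stub (h : StubRealCubic) : SzpiroOnRealClass 8 := by
  have h' := szpiroOnRealClass_of_stub discrLaw_1944_2 h
  norm_num at h'
  exact h'

/-- k3's **L♮** (`StubIdeas3SketchG2.natAbs_discr_dvd_four_mul_conductorNorm`, conjectured sharp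
conductor law, certificate j344484; NOT retyped as a target here) as a hypothesis: `|d_K| ∣ 4·N`. -/
def DiscrDvdFourConductor : Prop :=
  ∀ (W : WeierstrassCurve ℚ) [W.IsElliptic] (K : Type) [Field K] [NumberField K],
    Irreducible W.twoTorsionPolynomial.toPoly → Module.finrank ℚ K = 3 →
    (∃ θ : K, Polynomial.aeval θ W.twoTorsionPolynomial.toPoly = 0) →
    (NumberField.discr K).natAbs ∣ 4 * W.conductorNorm ℤ

theorem discrLaw_4_1_of (hL : DiscrDvdFourConductor) : DiscrLaw 4 1 := by
  intro W _ K _ _ hirr hdeg hθ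
  have hN0 : W.conductorNorm ℤ ≠ 0 := (W.conductorNorm_pos_holds).ne'
  have hle : (NumberField.discr K).natAbs ≤ 4 * W.conductorNorm ℤ :=
    Nat.le_of_dvd (by positivity) (hL W K hirr hdeg hθ)
  have habs : |(NumberField.discr K : ℝ)| = ((NumberField.discr K).natAbs : ℝ) := by
    rw [Nat.cast_natAbs, Int.cast_abs]
  rw [habs, pow_one]
  exact_mod_cast hle

/-- **Upper edge modulo L♮:** `stub_realCubic ⇒ Szpiro(7+ε)` on the real class. -/
theorem szpiroOnRealClass_seven_of_stub (hL : DiscrDvdFourConductor) (h : StubRealCubic) :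
    SzpiroOnRealClass 7 := by
  have h' := szpiroOnRealClass_of_stub (discrLaw_4_1_of hL) h
  norm_num at h'
  exact h'

/-! ## §3 Prime-conductor calibration: the allowance is used (`I ∣ 16`), exponent `4`, `2`, `0` -/

/-- k3's **N1★** (`StubIdeas3SketchG2.exists_index_sq_eq`, the index identity `2⁸·Δ_min = I²·|d_K|`,
one–two prover cycles from `Algebra.discr_powerBasis_eq_prod''` + Mathlib
`WeierstrassCurve.twoTorsionPolynomial_discr`; NOT retyped as a target here) as a hypothesis. -/
def IndexIdentity : Prop :=
  ∀ (W : WeierstrassCurve ℚ) [W.IsElliptic] (K : Type) [Field K] [NumberField K],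
    Irreducible W.twoTorsionPolynomial.toPoly → Module.finrank ℚ K = 3 →
    (∃ θ : K, Polynomial.aeval θ W.twoTorsionPolynomial.toPoly = 0) →
    ∃ I : ℕ, 0 < I ∧ 2 ^ 8 * W.minimalDiscriminantNorm ℤ = I ^ 2 * (NumberField.discr K).natAbs

/-- **Parity** (N1★ ⇒ k3's N1c/H2, all primes incl. 2): an odd `p`-tower of `Δ_min` forces `p ∣ d_K`. -/
theorem dvd_discr_of_odd_factorization (hN1 : IndexIdentity) (W : WeierstrassCurve ℚ) [W.IsElliptic]
    (K : Type) [Field K] [NumberField K] (hirr : Irreducible W.twoTorsionPolynomial.toPoly)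
    (hdeg : Module.finrank ℚ K = 3) (hθ : ∃ θ : K, Polynomial.aeval θ W.twoTorsionPolynomial.toPoly = 0)
    {p : ℕ} (hodd : Odd ((W.minimalDiscriminantNorm ℤ).factorization p)) :
    p ∣ (NumberField.discr K).natAbs := by
  obtain ⟨I, hI0, hI⟩ := hN1 W K hirr hdeg hθ
  have hd0 : (NumberField.discr K).natAbs ≠ 0 := Int.natAbs_ne_zero.mpr (NumberField.discr_ne_zero K)
  have hm0 : W.minimalDiscriminantNorm ℤ ≠ 0 := (W.minimalDiscriminantNorm_pos_holds).ne'
  have h := congrArg (fun n : ℕ => n.factorization p) hI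
  rw [Nat.factorization_mul (by positivity) hm0, Nat.factorization_mul (pow_ne_zero _ hI0.ne') hd0,
    Nat.factorization_pow, Nat.factorization_pow, Finsupp.add_apply, Finsupp.add_apply,
    Finsupp.smul_apply, Finsupp.smul_apply, smul_eq_mul, smul_eq_mul] at h
  by_contra hnd
  have hdp : (NumberField.discr K).natAbs.factorization p = 0 := Nat.factorization_eq_zero_of_not_dvd hnd
  obtain ⟨k, hk⟩ := hodd
  omega

/-- **Parity, general form** (= k3's N1c with N1★ as an explicit hypothesis): `v_p(Δ_min) ≡ v_p(d_K) (mod 2)`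
at every prime `p` (incl. `2`, where `v₂(2⁸) = 8` is even). -/
theorem even_factorization_add (hN1 : IndexIdentity) (W : WeierstrassCurve ℚ) [W.IsElliptic]
    (K : Type) [Field K] [NumberField K] (hirr : Irreducible W.twoTorsionPolynomial.toPoly)
    (hdeg : Module.finrank ℚ K = 3) (hθ : ∃ θ : K, Polynomial.aeval θ W.twoTorsionPolynomial.toPoly = 0)
    (p : ℕ) :
    Even ((W.minimalDiscriminantNorm ℤ).factorization p + (NumberField.discr K).natAbs.factorization p) := by
  obtain ⟨I, hI0, hI⟩ := hN1 W K hirr hdeg hθ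
  have hd0 : (NumberField.discr K).natAbs ≠ 0 := Int.natAbs_ne_zero.mpr (NumberField.discr_ne_zero K)
  have hm0 : W.minimalDiscriminantNorm ℤ ≠ 0 := (W.minimalDiscriminantNorm_pos_holds).ne'
  have h := congrArg (fun n : ℕ => n.factorization p) hI
  rw [Nat.factorization_mul (by positivity) hm0, Nat.factorization_mul (pow_ne_zero _ hI0.ne') hd0,
    Nat.factorization_pow, Nat.factorization_pow, Finsupp.add_apply, Finsupp.add_apply,
    Finsupp.smul_apply, Finsupp.smul_apply, smul_eq_mul, smul_eq_mul] at h
  rw [Nat.even_iff]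
  omega

/-- **N1♯-loc from N1★ by parity alone** (k3's `two_dvd_conductorNorm_of_factorization_two_eq_three`,
sorried there; IMPORT found: no Galois theory / finite flat group schemes needed): `2 ∤ N ⇒ 2 ∤ Δ_min`
(`WeierstrassCurve.primeFactors_minimalDiscriminantNorm`, Silverman VII.5.1) `⇒ v₂(d_K) ≡ 8 ≡ 0 (mod 2)`,
contradicting `v₂(d_K) = 3`.  So good reduction at `2` forces `v₂(d_K) ∈ {0, 2}`. -/
theorem two_dvd_conductorNorm_of_factorization_two_eq_three (hN1 : IndexIdentity)
    (W : WeierstrassCurve ℚ) [W.IsElliptic] (K : Type) [Field K] [NumberField K]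
    (hirr : Irreducible W.twoTorsionPolynomial.toPoly) (hdeg : Module.finrank ℚ K = 3)
    (hθ : ∃ θ : K, Polynomial.aeval θ W.twoTorsionPolynomial.toPoly = 0)
    (h3 : (NumberField.discr K).natAbs.factorization 2 = 3) : 2 ∣ W.conductorNorm ℤ := by
  by_contra h2N
  have hpar := even_factorization_add hN1 W K hirr hdeg hθ 2
  have hnot : ¬ 2 ∣ W.minimalDiscriminantNorm ℤ := by
    intro h2Δ
    have hmem : 2 ∈ (W.minimalDiscriminantNorm ℤ).primeFactors :=
      Nat.mem_primeFactors.mpr ⟨Nat.prime_two, h2Δ, (W.minimalDiscriminantNorm_pos_holds).ne'⟩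
    rw [W.primeFactors_minimalDiscriminantNorm] at hmem
    exact h2N (Nat.dvd_of_mem_primeFactors hmem)
  have h0 : (W.minimalDiscriminantNorm ℤ).factorization 2 = 0 := Nat.factorization_eq_zero_of_not_dvd hnot
  rw [h0, h3] at hpar
  exact absurd hpar (by decide)

/-- **Odd primes of good reduction are unramified-to-even-order in `K`**: `p ∤ N ⇒ v_p(d_K)` even (with the
tree caps: `= 0` for `p ≥ 5` by `not_dvd_discr_divisionField_two`; `∈ {0, 2, 4}` at `3` — in fact `0`, same
lemma).  Recorded as the parity half of L♮'s local dictionary. -/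
theorem even_factorization_discr_of_not_dvd_conductorNorm (hN1 : IndexIdentity)
    (W : WeierstrassCurve ℚ) [W.IsElliptic] (K : Type) [Field K] [NumberField K]
    (hirr : Irreducible W.twoTorsionPolynomial.toPoly) (hdeg : Module.finrank ℚ K = 3)
    (hθ : ∃ θ : K, Polynomial.aeval θ W.twoTorsionPolynomial.toPoly = 0) {p : ℕ} (hp : p.Prime)
    (hpN : ¬ p ∣ W.conductorNorm ℤ) : Even ((NumberField.discr K).natAbs.factorization p) := by
  have hpar := even_factorization_add hN1 W K hirr hdeg hθ p
  have hnot : ¬ p ∣ W.minimalDiscriminantNorm ℤ := by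
    intro hpΔ
    have hmem : p ∈ (W.minimalDiscriminantNorm ℤ).primeFactors :=
      Nat.mem_primeFactors.mpr ⟨hp, hpΔ, (W.minimalDiscriminantNorm_pos_holds).ne'⟩
    rw [W.primeFactors_minimalDiscriminantNorm] at hmem
    exact hpN (Nat.dvd_of_mem_primeFactors hmem)
  rwa [Nat.factorization_eq_zero_of_not_dvd hnot, zero_add] at hpar

/-- **Calibration rung (ε-free, `C = 1`, exponent 4, both signs):** for PRIME conductor `N = p`,
`Δ_min ≤ |d_K|·N⁴` on the `r = 0` class — from M–O Thm 1 (`v_p(Δ_min) ≤ 5`, vendored tree fact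
`mestreOesterle_factorization_le_five`) and N1★: `m ≤ 4` is trivial, and `m = 5` is an odd tower, so
`p ∣ d_K` (e.g. `11a1`: `11⁵ ≤ 11⁴·44`).  The allowance is genuinely used here. -/
theorem minimalDiscriminantNorm_le_of_prime_conductorNorm (hMO : mestreOesterle_factorization_le_five)
    (hN1 : IndexIdentity) (W : WeierstrassCurve ℚ) [W.IsElliptic] (K : Type) [Field K] [NumberField K]
    (hirr : Irreducible W.twoTorsionPolynomial.toPoly) (hdeg : Module.finrank ℚ K = 3)
    (hθ : ∃ θ : K, Polynomial.aeval θ W.twoTorsionPolynomial.toPoly = 0)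
    (hp : (W.conductorNorm ℤ).Prime) :
    W.minimalDiscriminantNorm ℤ ≤ (NumberField.discr K).natAbs * W.conductorNorm ℤ ^ 4 := by
  set p := W.conductorNorm ℤ with hpdef
  set m := (W.minimalDiscriminantNorm ℤ).factorization p with hmdef
  have hm5 : m ≤ 5 := hMO W hp
  have hΔ : W.minimalDiscriminantNorm ℤ = p ^ m :=
    W.minimalDiscriminantNorm_eq_pow_of_prime_conductorNorm hp
  have hd1 : 1 ≤ (NumberField.discr K).natAbs :=
    Nat.one_le_iff_ne_zero.mpr (Int.natAbs_ne_zero.mpr (NumberField.discr_ne_zero K))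
  have hp1 : 1 ≤ p := hp.one_lt.le
  rcases Nat.lt_or_ge m 5 with hlt | hge
  · calc W.minimalDiscriminantNorm ℤ = p ^ m := hΔ
      _ ≤ p ^ 4 := Nat.pow_le_pow_right hp1 (by omega)
      _ = 1 * p ^ 4 := (one_mul _).symm
      _ ≤ (NumberField.discr K).natAbs * p ^ 4 := Nat.mul_le_mul_right _ hd1
  · have hm : m = 5 := le_antisymm hm5 hge
    have hodd : Odd m := by rw [hm]; exact ⟨2, rfl⟩
    have hpd : p ∣ (NumberField.discr K).natAbs :=
      dvd_discr_of_odd_factorization hN1 W K hirr hdeg hθ hodd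
    have hple : p ≤ (NumberField.discr K).natAbs := Nat.le_of_dvd (by omega) hpd
    calc W.minimalDiscriminantNorm ℤ = p ^ 5 := by rw [hΔ, hm]
      _ = p * p ^ 4 := by ring
      _ ≤ (NumberField.discr K).natAbs * p ^ 4 := Nat.mul_le_mul_right _ hple

/-- The same rung in the stub's currency: an ε-free instance of `IndexSzpiro` with `C = 1` and exponent
`4 < 6` on prime conductor (any sign of `d_K`). -/
theorem stubRealCubic_rung_prime (hMO : mestreOesterle_factorization_le_five) (hN1 : IndexIdentity)
    (W : WeierstrassCurve ℚ) [W.IsElliptic] (K : Type) [Field K] [NumberField K]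
    (hirr : Irreducible W.twoTorsionPolynomial.toPoly) (hdeg : Module.finrank ℚ K = 3)
    (hθ : ∃ θ : K, Polynomial.aeval θ W.twoTorsionPolynomial.toPoly = 0)
    (hp : (W.conductorNorm ℤ).Prime) :
    (W.minimalDiscriminantNorm ℤ : ℝ) ≤
      1 * |(NumberField.discr K : ℝ)| * (W.conductorNorm ℤ : ℝ) ^ (4 : ℝ) := by
  have h := minimalDiscriminantNorm_le_of_prime_conductorNorm hMO hN1 W K hirr hdeg hθ hp
  have habs : |(NumberField.discr K : ℝ)| = ((NumberField.discr K).natAbs : ℝ) := by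
    rw [Nat.cast_natAbs, Int.cast_abs]
  rw [habs, one_mul, show (4 : ℝ) = ((4 : ℕ) : ℝ) by norm_num, Real.rpow_natCast]
  exact_mod_cast h

/-- **Mestre–Oesterlé 1989, §5 Théorème 2 (p. 183), printed form minus curve labels** (PROPOSED named
fact; "courbe de Weil" dropped by modularity): prime conductor `p` ⇒ `Δ_min = p`, unless
`p ∈ {11, 17, 19, 37}` or `p = u² + 64`.  Hypothesis here. [MestreOesterle1989, §5 Thm 2; acq-02587] -/
def MestreOesterleThm2 : Prop :=
  ∀ (W : WeierstrassCurve ℚ) [W.IsElliptic], (W.conductorNorm ℤ).Prime →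
    W.minimalDiscriminantNorm ℤ = W.conductorNorm ℤ ∨
      W.conductorNorm ℤ ∈ ({11, 17, 19, 37} : Finset ℕ) ∨ ∃ u : ℕ, W.conductorNorm ℤ = u ^ 2 + 64

/-- **Thm 2, no-rational-2-torsion form** (PROPOSED; the exceptional curves `17B, 17C, SN_A(u²+64)` have
a rational 2-torsion point, so an IRREDUCIBLE 2-division cubic leaves only `11B = 11a1` (`Δ = −11⁵`),
`19B = 19a1` (`−19³`), `37C = 37b1` (`37³`) — labels to be verified against the paper, acq-02587,
before this is filed as a Literature fact). -/
def MestreOesterleThm2Irred : Prop :=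
  ∀ (W : WeierstrassCurve ℚ) [W.IsElliptic], (W.conductorNorm ℤ).Prime →
    Irreducible W.twoTorsionPolynomial.toPoly →
    W.minimalDiscriminantNorm ℤ = W.conductorNorm ℤ ∨
      (W.conductorNorm ℤ = 11 ∧ W.minimalDiscriminantNorm ℤ = 11 ^ 5) ∨
      (W.conductorNorm ℤ = 19 ∧ W.minimalDiscriminantNorm ℤ = 19 ^ 3) ∨
      (W.conductorNorm ℤ = 37 ∧ W.minimalDiscriminantNorm ℤ = 37 ^ 3)

/-- **Sharp calibration (exponent 0):** prime conductor `p ∉ {11, 19, 37}` ⇒ `Δ_min = p ∣ d_K`, so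
`Δ_min ≤ |d_K|` (`C = 1`, `ι = 0`; the index `I` divides `16`). Modulo Thm 2 (irreducible form) + N1★. -/
theorem minimalDiscriminantNorm_le_discr_of_prime (hMO2 : MestreOesterleThm2Irred) (hN1 : IndexIdentity)
    (W : WeierstrassCurve ℚ) [W.IsElliptic] (K : Type) [Field K] [NumberField K]
    (hirr : Irreducible W.twoTorsionPolynomial.toPoly) (hdeg : Module.finrank ℚ K = 3)
    (hθ : ∃ θ : K, Polynomial.aeval θ W.twoTorsionPolynomial.toPoly = 0)
    (hp : (W.conductorNorm ℤ).Prime) (h11 : W.conductorNorm ℤ ≠ 11) (h19 : W.conductorNorm ℤ ≠ 19)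
    (h37 : W.conductorNorm ℤ ≠ 37) :
    W.minimalDiscriminantNorm ℤ ≤ (NumberField.discr K).natAbs := by
  have hd0 : (NumberField.discr K).natAbs ≠ 0 := Int.natAbs_ne_zero.mpr (NumberField.discr_ne_zero K)
  rcases hMO2 W hp hirr with hΔ | ⟨h, -⟩ | ⟨h, -⟩ | ⟨h, -⟩
  · have hodd : Odd ((W.minimalDiscriminantNorm ℤ).factorization (W.conductorNorm ℤ)) := by
      rw [hΔ, Nat.Prime.factorization_self hp]; exact odd_one
    have hpd := dvd_discr_of_odd_factorization hN1 W K hirr hdeg hθ hodd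
    rw [hΔ]
    exact Nat.le_of_dvd (Nat.pos_of_ne_zero hd0) hpd
  · exact absurd h h11
  · exact absurd h h19
  · exact absurd h h37

/-- **Exponent 2 for `p ≠ 11`** (covers the real exception `37C`, `37³ ≤ 37²·|d_K|` since `v₃₇(Δ)` is
odd, and `19B`): prime conductor `p ≠ 11` ⇒ `Δ_min ≤ |d_K|·N²`.  The real class (`d_K > 0`) never meets
`11B` (`Δ < 0`), so on `stub_realCubic`'s prime-conductor class the exponent is `2`. -/
theorem minimalDiscriminantNorm_le_discr_mul_sq_of_prime (hMO2 : MestreOesterleThm2Irred)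
    (hN1 : IndexIdentity) (W : WeierstrassCurve ℚ) [W.IsElliptic] (K : Type) [Field K] [NumberField K]
    (hirr : Irreducible W.twoTorsionPolynomial.toPoly) (hdeg : Module.finrank ℚ K = 3)
    (hθ : ∃ θ : K, Polynomial.aeval θ W.twoTorsionPolynomial.toPoly = 0)
    (hp : (W.conductorNorm ℤ).Prime) (h11 : W.conductorNorm ℤ ≠ 11) :
    W.minimalDiscriminantNorm ℤ ≤ (NumberField.discr K).natAbs * W.conductorNorm ℤ ^ 2 := by
  have hd0 : (NumberField.discr K).natAbs ≠ 0 := Int.natAbs_ne_zero.mpr (NumberField.discr_ne_zero K)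
  have hd1 : 1 ≤ (NumberField.discr K).natAbs := Nat.one_le_iff_ne_zero.mpr hd0
  have hN1' : 1 ≤ W.conductorNorm ℤ ^ 2 := Nat.one_le_pow _ _ hp.pos
  rcases hMO2 W hp hirr with hΔ | ⟨h, -⟩ | ⟨hN, hΔ⟩ | ⟨hN, hΔ⟩
  · have hodd : Odd ((W.minimalDiscriminantNorm ℤ).factorization (W.conductorNorm ℤ)) := by
      rw [hΔ, Nat.Prime.factorization_self hp]; exact odd_one
    have hpd := dvd_discr_of_odd_factorization hN1 W K hirr hdeg hθ hodd
    have hle : W.conductorNorm ℤ ≤ (NumberField.discr K).natAbs := Nat.le_of_dvd (Nat.pos_of_ne_zero hd0) hpd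
    calc W.minimalDiscriminantNorm ℤ = W.conductorNorm ℤ * 1 := by rw [hΔ, mul_one]
      _ ≤ (NumberField.discr K).natAbs * W.conductorNorm ℤ ^ 2 := Nat.mul_le_mul hle hN1'
  · exact absurd h h11
  · -- `19B`: `Δ = 19³`, odd tower ⇒ `19 ∣ d_K`
    have hodd : Odd ((W.minimalDiscriminantNorm ℤ).factorization (W.conductorNorm ℤ)) := by
      rw [hΔ, hN, show (19 : ℕ) ^ 3 = 19 ^ 3 from rfl, Nat.factorization_pow,
        Finsupp.smul_apply, smul_eq_mul, Nat.Prime.factorization_self (by norm_num)]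
      exact ⟨1, rfl⟩
    have hpd := dvd_discr_of_odd_factorization hN1 W K hirr hdeg hθ hodd
    rw [hN] at hpd
    have hle : 19 ≤ (NumberField.discr K).natAbs := Nat.le_of_dvd (Nat.pos_of_ne_zero hd0) hpd
    rw [hΔ, hN]
    calc (19 : ℕ) ^ 3 = 19 * 19 ^ 2 := by norm_num
      _ ≤ (NumberField.discr K).natAbs * 19 ^ 2 := Nat.mul_le_mul_right _ hle
  · -- `37C`: `Δ = 37³`, odd tower ⇒ `37 ∣ d_K`
    have hodd : Odd ((W.minimalDiscriminantNorm ℤ).factorization (W.conductorNorm ℤ)) := by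
      rw [hΔ, hN, Nat.factorization_pow, Finsupp.smul_apply, smul_eq_mul,
        Nat.Prime.factorization_self (by norm_num)]
      exact ⟨1, rfl⟩
    have hpd := dvd_discr_of_odd_factorization hN1 W K hirr hdeg hθ hodd
    rw [hN] at hpd
    have hle : 37 ≤ (NumberField.discr K).natAbs := Nat.le_of_dvd (Nat.pos_of_ne_zero hd0) hpd
    rw [hΔ, hN]
    calc (37 : ℕ) ^ 3 = 37 * 37 ^ 2 := by norm_num
      _ ≤ (NumberField.discr K).natAbs * 37 ^ 2 := Nat.mul_le_mul_right _ hle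

end Summit.ABC.ABC.Cruxes.IndexSzpiro.StubIdeas1RealG3

end
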